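import Literature.AnabelianGeometry.EtaleTheta.Discharge.Sec5Prop55OfLaws
import Literature.AnabelianGeometry.EtaleTheta.Discharge.Sec5CyclotomicRigidityOfBiKummerData
import HarnessLib

/-!
# [EtTh] Prop. 5.5 at the GENUINE §5 data with the P55-L06 input DISCHARGED modulo structural laws (proof-only)

Mochizuki, *The étale theta function and its Frobenioid-theoretic manifestations*, Publ. RIMS **45** (2009)
[EtTh], Prop. 5.5, proof pp.327–328 (PDF pp.101–102) [cite: MochizukiEtTh2009, Prop 5.5 proof p.328 (PDF p.102)].
abc-iut cell, layer L2, sub-DAG `plan/L2/SUBDAG-EtTh-Thm56.md`, leaf **P55-L06** at the genuine data (seat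
abc-iut-w4-d008 g2; «abstract-datum level first, model instance second»).  PROOF-ONLY (no definitions).

For the §5 data `𝔉 := ThetaFrobenioid.ofBiKummerData …` assembled by abc-iut-L2-t4 (W3-L2-01), this file plugs the
abstract derivation of P55-L06 (`Thm56Sub.transportIndependent_of_thetaPair`, `Thm56Sub.cyclotomicRigidity_of_laws`;
this seat, `Discharge/Sec5Prop55TransportIndependent.lean` + `Discharge/Sec5Prop55OfLaws.lean`) into abc-iut-w5-d020's
assembly `cyclotomicRigidity_ofBiKummerData` (`Discharge/Sec5CyclotomicRigidityOfBiKummerData.lean`), DISCHARGING at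
the data: (U) «the unit pull-back depends only on the base morphism» (definitional: `ModelFrobenioid.unitsPull`,
[FrdI] Thm. 5.2 (ii)) — `unitsPullCongrBase_ofBiKummerData`; (S) `SgpCapSection` modulo `hσ` (abc-iut-L2-t4's
`sgpCapSection_ofBiKummerData`); T56-L09d / P55-L06b unit laws (abc-iut-w5-d020's `unitsPullSpec/Comp/Id_ofBiKummerData`);
centrality P55-L02b (abc-iut-w5-d020's `unitsCentralUnderLDelta_ofBiKummerData` mod `hσ hgeom hconst`); P55-L02
(abc-iut-w5-d123's `exists_eta_etaTautological_ofBiKummerData`) and coverage (`lDeltaCovered_ofBiKummerData`).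

* `transportIndependent_ofBiKummerData` — **P55-L06 `Thm56Sub.TransportIndependent 𝔉 ν` at the genuine data**, for
  the `ν` pinned by the Prop. 5.2 (iii) class, MODULO the named inputs of abc-iut-w5-d020's assembly it shares (`hK`-instance
  `ThetaPairKummerClass η ν`, `EtaTautological P η`, `hσ`, `hgeom`, `hconst`, `hreach`, `hLc`/`hLi`, coverage) and the
  three STRUCTURAL laws of the base / subquotient / bi-Kummer data that replace P55-L06:
  (G) `hgal` — «`B_N^bs` is Galois» (p.331 (PDF p.105)): the base maps of two linear `B_N ⟶ T`, `T` theta-saturated,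
  differ by an element of `Aut_D(B_N^bs)`;
  `hproj` — the transport of `(l·Δ_Θ)_{B_N}` along `g ∈ Aut_D(B_N^bs)` is transport of structure `σ ↦ g σ g⁻¹` on the
  subquotient datum `P` (p.327 (PDF p.101));
  `hcup` — `s^⊔-gp_N(g h g⁻¹) = s^⊓-gp_N(g) · s^⊔-gp_N(h) · s^⊓-gp_N(g)⁻¹` over `(l·Δ_Θ)` (Galois-equivariance of the
  étale theta class on `l·Δ_Θ`, Prop. 1.3; p.329 (PDF p.103) l.17–21).
* The full assembly with `hind` replaced by these laws is abc-iut-w5-d020's `cyclotomicRigidity_ofBiKummerData_of_laws`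
  (`Discharge/Sec5CyclotomicRigidityOfBiKummerDataLaws.lean`, via this seat's `Thm56Sub.cyclotomicRigidity_of_laws`).
HONEST FRAMING: kernel-checked implications between typed statements about the assembled §5 data; nothing of [EtTh]
is asserted unconditionally; nothing asserts that such data exist for an actual curve; typed ≠ discharged; no side
taken on [IUTchIII] Cor. 3.12.
-/

noncomputable section

namespace Literature.AnabelianGeometry.EtaleTheta

open CategoryTheory Opposite FrobenioidCyclotomicRigidity Literature.AlgebraicGeometry.Frobenioids

universe u₀ v₀ u v w

namespace ThetaFrobenioid

variable {K : Type u₀} [Field K]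
  {X : SemiGraphs.TemperedArithmeticGroup.{u₀} K} {D₀ : Type u₀} [Category.{v₀} D₀]
  {V : FrdIMonoidStub.{w}} {T₀ : RealifiedDivisorMonoids (D₀ := D₀) V} {D : Type u} [Category.{v} D]
  {VD : FrdICatStub.{u, v, w} D} {S : BiKummerSetting X T₀ D VD}
  {pullFrac : ∀ {A A' : S.C} (_ : A' ⟶ A), S.biratUnits A → S.biratUnits A'}
  {lv N : ℕ+} {l' : ℕ} {RD : RigidData.{max v w} N l'} {θ : S.biratUnits S.Aodot} {Bl : S.C}
  {Pl : S.FractionPair θ Bl} {Rl : S.NthRoot θ Pl lv pullFrac}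
  (h : ModelFrobenioid.Hypotheses S.tf.divisorMonoid S.tf.ratFnFunctor)
  (toB : ∀ A : S.C, S.biratUnits A →* S.tf.biratUnitsModel A) (Q : FrobenioidTheta.ThetaSubquotientStub.{w} D)
  (odd_l : Odd (lv : ℕ)) (R : S.NthRoot Rl.root Rl.pair N pullFrac) (ιX : RD.PiX ≃ₜ* X.Pi)
  (hopen : IsOpen ((S.galoisSurj R.AN.base R.αData.isGalois).ker : Set X.Pi)) (σ : Aut R.AN.base →* Aut R.AN)
  (K' : Type w) [Field K'] (constEmb : K'ˣ →* S.tf.biratUnitsModel R.BN)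
  (constEmb_injective : Function.Injective constEmb)
  (hdivc : ∀ g : Aut R.BN.base,
    ModelFrobenioid.div ((σ ((BiKummerSetting.NthRoot.baseIso S R).conjAut.symm g)).hom ≫ R.pair.num) =
      ModelFrobenioid.div R.pair.num)
  (hdivp : ∀ y : RD.PiYdd,
    ModelFrobenioid.div ((σ (S.galoisSurj R.AN.base R.αData.isGalois (ιX y.1))).hom ≫ R.pair.den) =
      ModelFrobenioid.div R.pair.den)

/-- **Law (U) at the genuine data**: the stub's unit pull-back of the assembled data IS `ModelFrobenioid.unitsPull`,
which depends only on the base morphism ([FrdI] Thm. 5.2 (ii); `ModelFrobenioid.unitsPull_congr_baseMap`).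
[cite: MochizukiEtTh2009, Prop 5.5 proof p.328 (PDF p.102)] -/
theorem unitsPullCongrBase_ofBiKummerData {S' T' : S.C} (φ ψ : S' ⟶ T')
    (hb : (ofBiKummerData h toB Q odd_l R ιX hopen σ K' constEmb constEmb_injective hdivc hdivp).base.map φ =
      (ofBiKummerData h toB Q odd_l R ιX hopen σ K' constEmb constEmb_injective hdivc hdivp).base.map ψ) :
    (ofBiKummerData h toB Q odd_l R ιX hopen σ K' constEmb constEmb_injective hdivc hdivp).unitsPull φ =
      (ofBiKummerData h toB Q odd_l R ιX hopen σ K' constEmb constEmb_injective hdivc hdivp).unitsPull ψ :=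
  ModelFrobenioid.unitsPull_congr_baseMap hb

/-- **[EtTh] Prop. 5.5, sub-node P55-L06 `TransportIndependent ν` AT THE GENUINE §5 DATA** («independent of the choice
of … the linear morphisms [precisely because of the original "functoriality" of the isomorphism for `S″`]», p.328 (PDF
p.102) l.8–11) for the isomorphism `ν` pinned by the Prop. 5.2 (iii) class — by `Thm56Sub.transportIndependent_of_thetaPair`
with (U), (S), T56-L09d, P55-L06b (unit side), P55-L02b DISCHARGED at the data; MODULO `hK` (pin), `hη` (P55-L02), `hσ`,
`hgeom`, `hconst`, `hreach`, `hLc`/`hLi` (free stub `Q`), `hcov` (coverage), and the structural laws (G) `hgal`, `hproj`,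
`hcup`.  [cite: MochizukiEtTh2009, Prop 5.5 proof p.328 (PDF p.102)] -/
theorem transportIndependent_ofBiKummerData
    (hB : (ofBiKummerData h toB Q odd_l R ιX hopen σ K' constEmb constEmb_injective hdivc hdivp).IsThetaSaturated
      (ofBiKummerData h toB Q odd_l R ιX hopen σ K' constEmb constEmb_injective hdivc hdivp).BN)
    (P : ThetaSubquotientProj (ofBiKummerData h toB Q odd_l R ιX hopen σ K' constEmb constEmb_injective hdivc hdivp))
    {η : (ofBiKummerData h toB Q odd_l R ιX hopen σ K' constEmb constEmb_injective hdivc hdivp).HB →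
      (ofBiKummerData h toB Q odd_l R ιX hopen σ K' constEmb constEmb_injective hdivc hdivp).lDeltaModN
        (ofBiKummerData h toB Q odd_l R ιX hopen σ K' constEmb constEmb_injective hdivc hdivp).BN}
    {ν : (ofBiKummerData h toB Q odd_l R ιX hopen σ K' constEmb constEmb_injective hdivc hdivp).lDeltaModN
        (ofBiKummerData h toB Q odd_l R ιX hopen σ K' constEmb constEmb_injective hdivc hdivp).BN ≃*
      (ofBiKummerData h toB Q odd_l R ιX hopen σ K' constEmb constEmb_injective hdivc hdivp).muTorsion
        (ofBiKummerData h toB Q odd_l R ιX hopen σ K' constEmb constEmb_injective hdivc hdivp).BN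
        (ofBiKummerData h toB Q odd_l R ιX hopen σ K' constEmb constEmb_injective hdivc hdivp).N}
    (hK : FrobenioidThetaBiKummer.ThetaPairKummerClass
      (ofBiKummerData h toB Q odd_l R ιX hopen σ K' constEmb constEmb_injective hdivc hdivp) η ν)
    (hη : Thm56Sub.EtaTautological
      (ofBiKummerData h toB Q odd_l R ιX hopen σ K' constEmb constEmb_injective hdivc hdivp) P η)
    (hσ : ∀ g : Aut R.AN.base, ModelFrobenioid.baseMap (σ g).hom = g.hom)
    (hgeom : P.pre R.BN.base ≤ RD.aug.ker.map (rhoOfBiKummerData R ιX))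
    (hconst : ∀ δ ∈ RD.aug.ker, ∀ τ : ModelFrobenioid.units R.BN,
      (S.tf.ratFnFunctor.map (rhoOfBiKummerData R ιX δ).hom.op).hom (ModelFrobenioid.unit τ.1.hom) =
        ModelFrobenioid.unit τ.1.hom)
    (hreach : LinearlyReachableFromBN
      (ofBiKummerData h toB Q odd_l R ιX hopen σ K' constEmb constEmb_injective hdivc hdivp))
    (hLc : Thm56Sub.LDeltaMapComp
      (ofBiKummerData h toB Q odd_l R ιX hopen σ K' constEmb constEmb_injective hdivc hdivp))
    (hLi : Thm56Sub.LDeltaMapId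
      (ofBiKummerData h toB Q odd_l R ιX hopen σ K' constEmb constEmb_injective hdivc hdivp))
    (hcov : Thm56Sub.LDeltaCovered
      (ofBiKummerData h toB Q odd_l R ιX hopen σ K' constEmb constEmb_injective hdivc hdivp) P)
    -- the three structural laws replacing P55-L06
    (hgal : ∀ (T : S.C),
      (ofBiKummerData h toB Q odd_l R ιX hopen σ K' constEmb constEmb_injective hdivc hdivp).IsThetaSaturated T →
      ∀ (φ φ' : (ofBiKummerData h toB Q odd_l R ιX hopen σ K' constEmb constEmb_injective hdivc hdivp).BN ⟶ T),
        (ofBiKummerData h toB Q odd_l R ιX hopen σ K' constEmb constEmb_injective hdivc hdivp).IsLinear φ →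
        (ofBiKummerData h toB Q odd_l R ιX hopen σ K' constEmb constEmb_injective hdivc hdivp).IsLinear φ' →
          ∃ g : Aut ((ofBiKummerData h toB Q odd_l R ιX hopen σ K' constEmb constEmb_injective hdivc hdivp).base.obj
              (ofBiKummerData h toB Q odd_l R ιX hopen σ K' constEmb constEmb_injective hdivc hdivp).BN),
            (ofBiKummerData h toB Q odd_l R ιX hopen σ K' constEmb constEmb_injective hdivc hdivp).base.map φ' =
              g.hom ≫ (ofBiKummerData h toB Q odd_l R ιX hopen σ K' constEmb constEmb_injective hdivc hdivp).base.map φ)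
    (hproj : ∀ (g k : Aut ((ofBiKummerData h toB Q odd_l R ιX hopen σ K' constEmb constEmb_injective hdivc hdivp).base.obj
        (ofBiKummerData h toB Q odd_l R ιX hopen σ K' constEmb constEmb_injective hdivc hdivp).BN))
      (hk : k ∈ P.pre _), ∃ hgk : g * k * g⁻¹ ∈ P.pre _,
        (ofBiKummerData h toB Q odd_l R ιX hopen σ K' constEmb constEmb_injective hdivc hdivp).lDeltaMap g.hom
          (P.proj _ ⟨k, hk⟩) = P.proj _ ⟨g * k * g⁻¹, hgk⟩)
    (hcup : ∀ (g : Aut ((ofBiKummerData h toB Q odd_l R ιX hopen σ K' constEmb constEmb_injective hdivc hdivp).base.obj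
        (ofBiKummerData h toB Q odd_l R ιX hopen σ K' constEmb constEmb_injective hdivc hdivp).BN))
      (k : (ofBiKummerData h toB Q odd_l R ιX hopen σ K' constEmb constEmb_injective hdivc hdivp).HB),
      (k : Aut ((ofBiKummerData h toB Q odd_l R ιX hopen σ K' constEmb constEmb_injective hdivc hdivp).base.obj
        (ofBiKummerData h toB Q odd_l R ιX hopen σ K' constEmb constEmb_injective hdivc hdivp).BN)) ∈ P.pre _ →
        ∃ hmem : g * (k : Aut ((ofBiKummerData h toB Q odd_l R ιX hopen σ K' constEmb constEmb_injective hdivc hdivp).base.obj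
            (ofBiKummerData h toB Q odd_l R ιX hopen σ K' constEmb constEmb_injective hdivc hdivp).BN)) * g⁻¹ ∈
            (ofBiKummerData h toB Q odd_l R ιX hopen σ K' constEmb constEmb_injective hdivc hdivp).HB,
          (ofBiKummerData h toB Q odd_l R ιX hopen σ K' constEmb constEmb_injective hdivc hdivp).sgpCup
              ⟨g * (k : Aut ((ofBiKummerData h toB Q odd_l R ιX hopen σ K' constEmb constEmb_injective hdivc hdivp).base.obj
                (ofBiKummerData h toB Q odd_l R ιX hopen σ K' constEmb constEmb_injective hdivc hdivp).BN)) * g⁻¹, hmem⟩ =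
            (ofBiKummerData h toB Q odd_l R ιX hopen σ K' constEmb constEmb_injective hdivc hdivp).sgpCap g *
              (ofBiKummerData h toB Q odd_l R ιX hopen σ K' constEmb constEmb_injective hdivc hdivp).sgpCup k *
              ((ofBiKummerData h toB Q odd_l R ιX hopen σ K' constEmb constEmb_injective hdivc hdivp).sgpCap g)⁻¹) :
    Thm56Sub.TransportIndependent (ofBiKummerData h toB Q odd_l R ιX hopen σ K' constEmb constEmb_injective hdivc hdivp)
      ν :=
  Thm56Sub.transportIndependent_of_thetaPair P hK hη
    (Thm56Sub.cyclotomeCentral_of_unitsCentral _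
      (unitsCentralUnderLDelta_ofBiKummerData h toB Q odd_l R ιX hopen σ K' constEmb constEmb_injective hdivc hdivp
        hσ P hgeom hconst))
    (Thm56Sub.bijectivelyReachableFromBN_of _ hB hreach)
    (unitsPullComp_ofBiKummerData h toB Q odd_l R ιX hopen σ K' constEmb constEmb_injective hdivc hdivp) hLc hLi
    (unitsPullSpec_ofBiKummerData h toB Q odd_l R ιX hopen σ K' constEmb constEmb_injective hdivc hdivp) hcov hgal
    (sgpCapSection_ofBiKummerData h toB Q odd_l R ιX hopen σ K' constEmb constEmb_injective hdivc hdivp hσ)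
    (fun φ ψ _ _ hb => unitsPullCongrBase_ofBiKummerData h toB Q odd_l R ιX hopen σ K' constEmb constEmb_injective
      hdivc hdivp φ ψ hb)
    hproj hcup

end ThetaFrobenioid

end Literature.AnabelianGeometry.EtaleTheta
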